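import Summits.ResolutionOfSingularities.ResolutionOfSingularities.Theorems.EquisingularLiftEquisingularLiftNatDeltaCriterion
import Literature.AlgebraicGeometry.Resolution.Dehomogenization
import Mathlib
import HarnessLib

/-!
# [OURS · L1 W4.5(b)] The Δ-CRITERION at ring level (3/3) — BRIDGE to the currency of T-CARRIER-Δ F3b:
# the uniformizer `θ ϖ̄_R`, and the trace read over ANY model `π : O ↠ k` of the residue field
# (crux `EquisingularLiftNat` = stmt-ResolutionOfSingularities-20038, line `sections`)

NOT a statement of any manuscript. Helper file of the chain res-L1-w45b (cell `res-hironaka`, rung L, slot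
W4.5(b)); AI-written, weaker than expert review; filed `--supports stmt-ResolutionOfSingularities-20038 --as helper`.
Continuation of `…Theorems.EquisingularLiftEquisingularLiftNatDeltaCriterion` (p512537).

THE SEAM. res-type-100's T-CARRIER-Δ (`…NatConeChart` p508912, `…NatCarrierDeltaStalks` p509910,
`…NatCarrierDeltaFlat` p512232, `…NatCarrierDeltaRegular` p513634) works at the stalk `R = 𝒪_{P, s(s₀)}` of the ambient at
the special point of the section: `c` a quasi-regular sequence generating the section's ideal `I = (c)` with `R/I` a
domain, `ϖ_R ∈ R` the germ of the uniformizer with `I + (ϖ_R) = 𝔪_R` and `ϖ_R ∉ I`, an identification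
`θ : R/I ≃+* Λ` with the base DVR, and a form `Φ`; its regularity clause (ii) takes as HYPOTHESIS, chart by chart, that
the Δ-curve ring `Λ[T_j : j ≠ i] ⧸ ((θ ∘ mk)(Φ(Tᵢ := 1)))` is a regular local ring at every prime containing `θ ϖ̄_R`
(«Δ-criterion in D1 (iii) currency»). The Δ-criterion files (1/3) p512537, (2/3) p513713 discharge exactly that, reading
the trace over `Λ/(ϖ)`; a consumer (res-D-pv-029's T-INST, res-D-pv-013's T-Δ-ISO) knows the trace over ITS field `k`.
This file bridges the two:
* `isDiscreteValuationRing_quotient_of_sup_span_eq_maximalIdeal` — `R` Noetherian local, `R/I` a domain,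
  `I ⊔ (ϖ) = 𝔪_R`, `ϖ ∉ I` ⇒ `R/I` is a DVR and `ϖ̄` is irreducible (Mathlib `IsDiscreteValuationRing.TFAE`);
  `maximalIdeal_eq_span_theta_mk` — hence `maximalIdeal Λ = (θ ϖ̄_R)` and `θ ϖ̄_R` is irreducible;
  `exists_ringEquiv_quotQuot_of_ker_eq_maximalIdeal` — `(R/I)/(ϖ̄) ≃+* k` for any `π : R ↠ k` with kernel `𝔪_R`.
* `notMem_sq_reduction_transport` — the ORDER-ONE condition on the trace («`f̄ ∉ 𝔪_𝔮²` at every `𝔮 ∋ f̄`») transports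
  along an isomorphism of residue fields (`notMem_sq_of_map_notMem_sq`, p501885, along `MvPolynomial.mapEquiv`).
* **`isRegularLocalRing_localization_deltaCurve_of_forall_notMem_sq_model`** — THE BRIDGE: `O` a DVR, `π : O ↠ k` a
  surjection onto a field with `ker π = (ϖ)` (ANY model of the residue field), `F ∈ O[x_σ]`: if the trace `V(π F)` is
  regular at every point of `𝔸^σ_k` (`π F ∉ 𝔪_𝔮²` at every prime `𝔮 ∋ π F`), then `O[x_σ]/(F)` is a regular local ring
  at every prime containing `ϖ` — for every lift `F`; `…_of_isRegularRing_model` (trace hypothesis as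
  `IsRegularRing (k[x_σ]/(π F))`, `π F ≠ 0`), `…_model'` (`ker π = 𝔪_O`, `ϖ` irreducible), and
  `isRegularLocalRing_localization_deltaCurve_dehomogenize_of_forall_notMem_sq_model` (`F = Φ(Tᵢ := 1)`, literally the
  chart ring of F3b, `σ = {j : Fin r // j ≠ i}`).

TOOLCHAIN NOTE: the base is kept a VARIABLE DVR `O` (never the quotient `R ⧸ I` itself) because in this Mathlib
`Localization.AtPrime` over `MvPolynomial σ (R ⧸ I) ⧸ J` does not elaborate without pinning `CommRing` by hand; F3b's
`θ : R/I ≃+* Λ` serves the same purpose.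

References: H. Matsumura, *Commutative Ring Theory* (1986), Thms. 11.2, 14.2. res-type-100 SIGNATURE T-CARRIER-Δ
2026-08-27 (OURS planning text, index only).
-/

set_option linter.dupNamespace false -- mandated namespace `Summit.<Summit>.<Problem>` of this single-conjunct summit

namespace Summit.ResolutionOfSingularities.ResolutionOfSingularities.Cruxes.EquisingularLiftNat.Sections

open MvPolynomial IsLocalRing Literature.AlgebraicGeometry.Resolution
open Summit.ResolutionOfSingularities.ResolutionOfSingularities.Theorems

universe u

/-! ## The base `R/I` is a DVR with uniformizer `ϖ̄` -/

section Base

variable {R : Type u} [CommRing R] [IsLocalRing R]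

/-- If `I ⊔ (ϖ) = 𝔪_R` then the maximal ideal of the local ring `R/I` is generated by `ϖ̄`. [folklore] -/
theorem maximalIdeal_quotient_eq_span_mk (I : Ideal R) [Nontrivial (R ⧸ I)] (ϖ : R)
    (h𝔪 : I ⊔ Ideal.span {ϖ} = maximalIdeal R) :
    haveI := IsLocalRing.of_surjective' (Ideal.Quotient.mk I) Ideal.Quotient.mk_surjective
    maximalIdeal (R ⧸ I) = Ideal.span {Ideal.Quotient.mk I ϖ} := by
  haveI := IsLocalRing.of_surjective' (Ideal.Quotient.mk I) Ideal.Quotient.mk_surjective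
  rw [← map_maximalIdeal_of_surjective (Ideal.Quotient.mk I) Ideal.Quotient.mk_surjective, ← h𝔪, Ideal.map_sup,
    Ideal.map_quotient_self, bot_sup_eq, Ideal.map_span, Set.image_singleton]

/-- **The base of the chart Δ-curve rings is a DVR.** Let `R` be a Noetherian local ring, `I` an ideal with `R/I` a
domain, and `ϖ ∈ R` with `I ⊔ (ϖ) = 𝔪_R` and `ϖ ∉ I` (res-type-100's stalk currency: `I = (c)` the section's ideal,
`ϖ` the germ of the uniformizer). Then `R/I` is a discrete valuation ring and `ϖ̄ = ϖ mod I` is irreducible (a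
uniformizer): `R/I` is a Noetherian local domain whose maximal ideal `(ϖ̄)` is principal and non-zero (Mathlib
`IsDiscreteValuationRing.TFAE`, Matsumura Thm. 11.2). [cite: Matsumura1987, Thm. 11.2] [OURS · L1 W4.5b] -/
theorem isDiscreteValuationRing_quotient_of_sup_span_eq_maximalIdeal [IsNoetherianRing R] (I : Ideal R)
    [IsDomain (R ⧸ I)] (ϖ : R) (h𝔪 : I ⊔ Ideal.span {ϖ} = maximalIdeal R) (hϖ : ϖ ∉ I) :
    IsDiscreteValuationRing (R ⧸ I) ∧ Irreducible (Ideal.Quotient.mk I ϖ) := by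
  haveI := IsLocalRing.of_surjective' (Ideal.Quotient.mk I) Ideal.Quotient.mk_surjective
  have hmax : maximalIdeal (R ⧸ I) = Ideal.span {Ideal.Quotient.mk I ϖ} := maximalIdeal_quotient_eq_span_mk I ϖ h𝔪
  have hne : Ideal.Quotient.mk I ϖ ≠ 0 := by rwa [Ne, Ideal.Quotient.eq_zero_iff_mem]
  have hnf : ¬ IsField (R ⧸ I) := by
    rw [IsLocalRing.isField_iff_maximalIdeal_eq, hmax, Ideal.span_singleton_eq_bot]
    exact hne
  have hprinc : (maximalIdeal (R ⧸ I)).IsPrincipal := ⟨⟨Ideal.Quotient.mk I ϖ, hmax⟩⟩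
  have hdvr : IsDiscreteValuationRing (R ⧸ I) := ((IsDiscreteValuationRing.TFAE (R ⧸ I) hnf).out 0 4).mpr hprinc
  exact ⟨hdvr, IsDiscreteValuationRing.irreducible_of_span_eq_maximalIdeal _ hne hmax⟩

/-- **Any model of the residue field.** For `I ⊔ (ϖ) = 𝔪_R` (`R/I` a domain, `ϖ ∉ I`, `R` Noetherian local) and a
surjection `π : R → k` onto a field with kernel `𝔪_R`, there is a ring isomorphism `ε : (R/I)/(ϖ̄) ≃+* k` with
`ε [[r]] = π r`. [folklore] [OURS · L1 W4.5b] -/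
theorem exists_ringEquiv_quotQuot_of_ker_eq_maximalIdeal [IsNoetherianRing R] (I : Ideal R) [IsDomain (R ⧸ I)]
    (ϖ : R) (h𝔪 : I ⊔ Ideal.span {ϖ} = maximalIdeal R) (hϖ : ϖ ∉ I)
    {k : Type u} [Field k] (π : R →+* k) (hπ : Function.Surjective π) (hker : RingHom.ker π = maximalIdeal R) :
    ∃ ε : ((R ⧸ I) ⧸ Ideal.span {Ideal.Quotient.mk I ϖ}) ≃+* k,
      ∀ r : R, ε (Ideal.Quotient.mk _ (Ideal.Quotient.mk I r)) = π r := by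
  have hIπ : ∀ a ∈ I, π a = 0 := fun a ha => by
    rw [← RingHom.mem_ker, hker, ← h𝔪]; exact Ideal.mem_sup_left ha
  -- `π` factors through `R/I`, then through `(R/I)/(ϖ̄)`
  let ψ₁ : R ⧸ I →+* k := Ideal.Quotient.lift I π hIπ
  have hϖψ₁ : ∀ a ∈ Ideal.span {Ideal.Quotient.mk I ϖ}, ψ₁ a = 0 := by
    intro a ha
    obtain ⟨b, rfl⟩ := Ideal.mem_span_singleton'.mp ha
    rw [map_mul, show ψ₁ (Ideal.Quotient.mk I ϖ) = π ϖ from Ideal.Quotient.lift_mk I π hIπ, show π ϖ = 0 from by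
      rw [← RingHom.mem_ker, hker, ← h𝔪]; exact Ideal.mem_sup_right (Ideal.mem_span_singleton_self ϖ), mul_zero]
  let ψ : (R ⧸ I) ⧸ Ideal.span {Ideal.Quotient.mk I ϖ} →+* k := Ideal.Quotient.lift _ ψ₁ hϖψ₁
  have hψ : ∀ r : R, ψ (Ideal.Quotient.mk _ (Ideal.Quotient.mk I r)) = π r := fun r => by
    change Ideal.Quotient.lift _ ψ₁ hϖψ₁ (Ideal.Quotient.mk _ (Ideal.Quotient.mk I r)) = π r
    rw [Ideal.Quotient.lift_mk]
    exact Ideal.Quotient.lift_mk I π hIπ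
  have hψsurj : Function.Surjective ψ := fun y => by
    obtain ⟨r, rfl⟩ := hπ y
    exact ⟨_, hψ r⟩
  -- `(R/I)/(ϖ̄)` is a field (`ϖ̄` generates the maximal ideal of the DVR `R/I`), so `ψ` is injective
  obtain ⟨hdvr, hirr⟩ := isDiscreteValuationRing_quotient_of_sup_span_eq_maximalIdeal I ϖ h𝔪 hϖ
  haveI := hdvr
  haveI hmaxϖ : (Ideal.span {Ideal.Quotient.mk I ϖ}).IsMaximal := PrincipalIdealRing.isMaximal_of_irreducible hirr
  letI : Field ((R ⧸ I) ⧸ Ideal.span {Ideal.Quotient.mk I ϖ}) := Ideal.Quotient.field _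
  have hψinj : Function.Injective ψ := ψ.injective
  exact ⟨RingEquiv.ofBijective ψ ⟨hψinj, hψsurj⟩, hψ⟩

end Base

/-! ## Transport of the order-one condition along an identification of residue fields -/

section Transport

variable {k₁ k₂ : Type u} [CommRing k₁] [CommRing k₂] {σ : Type u}

/-- **The order-one condition on the trace is independent of the model of the residue field.** For a ring
isomorphism `ε : k₁ ≃+* k₂` and `f₁ ∈ k₁[x_σ]` with image `f₂ = ε f₁ ∈ k₂[x_σ]`: if `f₂ ∉ 𝔪_𝔮²` at every prime
`𝔮 ∋ f₂` of `k₂[x_σ]`, then `f₁ ∉ 𝔪_𝔮²` at every prime `𝔮 ∋ f₁` of `k₁[x_σ]` (`notMem_sq_of_map_notMem_sq` along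
`MvPolynomial.mapEquiv σ ε`). [folklore] [OURS · L1 W4.5b] -/
theorem notMem_sq_reduction_transport (ε : k₁ ≃+* k₂) (f₁ : MvPolynomial σ k₁)
    (h2 : ∀ 𝔮 : PrimeSpectrum (MvPolynomial σ k₂), MvPolynomial.map (ε : k₁ →+* k₂) f₁ ∈ 𝔮.asIdeal →
      algebraMap (MvPolynomial σ k₂) (Localization.AtPrime 𝔮.asIdeal) (MvPolynomial.map (ε : k₁ →+* k₂) f₁) ∉
        maximalIdeal (Localization.AtPrime 𝔮.asIdeal) ^ 2)
    (𝔮 : PrimeSpectrum (MvPolynomial σ k₁)) (hf : f₁ ∈ 𝔮.asIdeal) :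
    algebraMap (MvPolynomial σ k₁) (Localization.AtPrime 𝔮.asIdeal) f₁ ∉
      maximalIdeal (Localization.AtPrime 𝔮.asIdeal) ^ 2 := by
  let E : MvPolynomial σ k₁ ≃+* MvPolynomial σ k₂ := MvPolynomial.mapEquiv σ ε
  -- the prime of `k₂[x_σ]` corresponding to `𝔮`
  let 𝔮₂ : PrimeSpectrum (MvPolynomial σ k₂) := PrimeSpectrum.comap (E.symm : MvPolynomial σ k₂ →+* _) 𝔮
  have h𝔮 : 𝔮.asIdeal = 𝔮₂.asIdeal.comap (E : MvPolynomial σ k₁ →+* MvPolynomial σ k₂) := by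
    change 𝔮.asIdeal = (𝔮.asIdeal.comap (E.symm : MvPolynomial σ k₂ →+* _)).comap (E : _ →+* _)
    rw [Ideal.comap_comap]
    ext a
    simp only [Ideal.mem_comap, RingHom.comp_apply, RingHom.coe_coe, RingEquiv.symm_apply_apply]
  have hE : (E : MvPolynomial σ k₁ →+* MvPolynomial σ k₂) f₁ = MvPolynomial.map (ε : k₁ →+* k₂) f₁ := rfl
  have hf₂ : MvPolynomial.map (ε : k₁ →+* k₂) f₁ ∈ 𝔮₂.asIdeal := by
    rw [← hE]
    have : f₁ ∈ 𝔮₂.asIdeal.comap (E : MvPolynomial σ k₁ →+* MvPolynomial σ k₂) := h𝔮 ▸ hf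
    exact this
  have h := h2 𝔮₂ hf₂
  rw [← hE] at h
  exact notMem_sq_of_map_notMem_sq (E : MvPolynomial σ k₁ →+* MvPolynomial σ k₂) 𝔮₂.asIdeal 𝔮.asIdeal h𝔮 h

end Transport

/-! ## The uniformizer in the stalk currency of T-CARRIER-Δ (`θ : R/(c) ≃+* Λ`) -/

section Theta

variable {R : Type u} [CommRing R] [IsLocalRing R] [IsNoetherianRing R]
variable {Λ : Type u} [CommRing Λ] [IsLocalRing Λ]

/-- **The transported uniformizer generates `𝔪_Λ` and is irreducible.** In res-type-100's F3b currency — `R`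
Noetherian local, `I = (c)` with `R/I` a domain, `ϖ_R ∈ R` with `I ⊔ (ϖ_R) = 𝔪_R` and `ϖ_R ∉ I`, and a ring
isomorphism `θ : R/I ≃+* Λ` onto a local ring (`Λ = O` via the section) —: `maximalIdeal Λ = (θ ϖ̄_R)` and `θ ϖ̄_R` is
irreducible; in particular `RingHom.ker π = maximalIdeal Λ` for a residue map `π` reads `ker π = (θ ϖ̄_R)`, the
hypothesis of `isRegularLocalRing_localization_deltaCurve_of_forall_notMem_sq_model` below. [folklore] [OURS · L1 W4.5b] -/
theorem maximalIdeal_eq_span_theta_mk (I : Ideal R) [IsDomain (R ⧸ I)] (ϖ : R)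
    (h𝔪 : I ⊔ Ideal.span {ϖ} = maximalIdeal R) (hϖ : ϖ ∉ I) (θ : (R ⧸ I) ≃+* Λ) :
    maximalIdeal Λ = Ideal.span {θ (Ideal.Quotient.mk I ϖ)} ∧ Irreducible (θ (Ideal.Quotient.mk I ϖ)) := by
  haveI := IsLocalRing.of_surjective' (Ideal.Quotient.mk I) Ideal.Quotient.mk_surjective
  have hmax : maximalIdeal (R ⧸ I) = Ideal.span {Ideal.Quotient.mk I ϖ} := maximalIdeal_quotient_eq_span_mk I ϖ h𝔪
  obtain ⟨-, hirr⟩ := isDiscreteValuationRing_quotient_of_sup_span_eq_maximalIdeal I ϖ h𝔪 hϖ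
  refine ⟨?_, (MulEquiv.irreducible_iff θ.toMulEquiv).mpr hirr⟩
  rw [← map_maximalIdeal_of_surjective (θ : (R ⧸ I) →+* Λ) θ.surjective, hmax, Ideal.map_span, Set.image_singleton]
  rfl

end Theta

/-! ## The bridge: the Δ-criterion with the trace read over ANY model of the residue field -/

section Bridge

variable {O : Type u} [CommRing O] [IsDomain O] [IsDiscreteValuationRing O] {ϖ : O}
variable {σ : Type u} [Finite σ]

/-- **BRIDGE: a Δ-curve is regular along `ϖ` wherever its trace — read over any model `π : O ↠ k` of the residue field —
is regular, for every lift.** `O` a DVR, `ϖ ∈ O` with a surjection `π : O → k` onto a field with `ker π = (ϖ)` (e.g.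
`O = W(k)` and its residue map, `ϖ = p`; or `Λ` with `ϖ = θ ϖ̄_R`, `maximalIdeal_eq_span_theta_mk`), `σ` finite,
`F ∈ O[x_σ]`. If the TRACE `V(π F) ⊂ 𝔸^σ_k` is regular at every point — `π F ∉ 𝔪_𝔮²` in `k[x_σ]_𝔮` for every prime
`𝔮 ∋ π F` (true when `π F ≠ 0` and `k[x_σ]/(π F)` is a regular ring, `notMem_sq_of_isRegularRing_quotient`, p512537) —
then the Δ-curve ring `O[x_σ]/(F)` is a regular local ring at every prime containing `ϖ`; no condition on the
`ϖ`-part of `F` (`isRegularLocalRing_localization_deltaCurve_of_forall_notMem_sq_reduction`, p512537, transported along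
`O/(ϖ) ≃+* k`). This is the hypothesis shape of res-type-100's `isRegular_carrierDelta_subscheme` (F3b) for one chart,
with `F := (θ ∘ mk)(Φ(T_j := 1))`. [cite: Matsumura1987, Thm. 14.2] [OURS · L1 W4.5b] -/
theorem isRegularLocalRing_localization_deltaCurve_of_forall_notMem_sq_model
    {k : Type u} [Field k] (π : O →+* k) (hπ : Function.Surjective π) (hker : RingHom.ker π = Ideal.span {ϖ})
    (F : MvPolynomial σ O)
    (h1 : ∀ 𝔮 : PrimeSpectrum (MvPolynomial σ k), MvPolynomial.map π F ∈ 𝔮.asIdeal →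
      algebraMap (MvPolynomial σ k) (Localization.AtPrime 𝔮.asIdeal) (MvPolynomial.map π F) ∉
        maximalIdeal (Localization.AtPrime 𝔮.asIdeal) ^ 2)
    (Q : Ideal (MvPolynomial σ O ⧸ Ideal.span {F})) [Q.IsPrime]
    (hQ : Ideal.Quotient.mk (Ideal.span {F}) (C ϖ : MvPolynomial σ O) ∈ Q) :
    IsRegularLocalRing (Localization.AtPrime Q) := by
  -- the model `ε : O/(ϖ) ≃+* k` induced by `π`
  let ε : (O ⧸ Ideal.span {ϖ}) ≃+* k :=
    (Ideal.quotEquivOfEq hker.symm).trans (RingHom.quotientKerEquivOfSurjective hπ)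
  have hε : ∀ r : O, ε (Ideal.Quotient.mk _ r) = π r := fun r => by
    change RingHom.quotientKerEquivOfSurjective hπ (Ideal.quotEquivOfEq hker.symm (Ideal.Quotient.mk _ r)) = π r
    rw [Ideal.quotEquivOfEq_mk, RingHom.quotientKerEquivOfSurjective_apply_mk]
  have hcomp : (ε : _ →+* k).comp (Ideal.Quotient.mk (Ideal.span {ϖ})) = π := RingHom.ext fun r => hε r
  have hred : MvPolynomial.map (ε : _ →+* k) (MvPolynomial.map (Ideal.Quotient.mk (Ideal.span {ϖ})) F) =
      MvPolynomial.map π F := by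
    rw [MvPolynomial.map_map, hcomp]
  refine isRegularLocalRing_localization_deltaCurve_of_forall_notMem_sq_reduction (ϖ := ϖ) (fun 𝔮 hf𝔮 => ?_) Q hQ
  refine notMem_sq_reduction_transport ε _ (fun 𝔮₂ h𝔮₂ => ?_) 𝔮 hf𝔮
  rw [hred] at h𝔮₂ ⊢
  exact h1 𝔮₂ h𝔮₂

/-- **BRIDGE, smooth-trace form.** Same, with the trace hypothesis as «`π F ≠ 0` and `k[x_σ]/(π F)` is a regular ring»
(e.g. a smooth affine plane curve; Mathlib `IsRegularRing`). [cite: Matsumura1987, Thm. 14.2] [OURS · L1 W4.5b] -/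
theorem isRegularLocalRing_localization_deltaCurve_of_isRegularRing_model
    {k : Type u} [Field k] (π : O →+* k) (hπ : Function.Surjective π) (hker : RingHom.ker π = Ideal.span {ϖ})
    (F : MvPolynomial σ O) (hF : MvPolynomial.map π F ≠ 0)
    (hreg : IsRegularRing (MvPolynomial σ k ⧸ Ideal.span {MvPolynomial.map π F}))
    (Q : Ideal (MvPolynomial σ O ⧸ Ideal.span {F})) [Q.IsPrime]
    (hQ : Ideal.Quotient.mk (Ideal.span {F}) (C ϖ : MvPolynomial σ O) ∈ Q) :
    IsRegularLocalRing (Localization.AtPrime Q) :=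
  haveI := hreg
  isRegularLocalRing_localization_deltaCurve_of_forall_notMem_sq_model π hπ hker F
    (fun 𝔮 hf𝔮 => notMem_sq_of_isRegularRing_quotient hF 𝔮 hf𝔮) Q hQ

/-- **BRIDGE with `ker π = 𝔪_O`** (the usual spelling for residue maps; `(ϖ) = 𝔪_O` for an irreducible `ϖ`).
[cite: Matsumura1987, Thm. 14.2] [OURS · L1 W4.5b] -/
theorem isRegularLocalRing_localization_deltaCurve_of_forall_notMem_sq_model' (hϖ : Irreducible ϖ)
    {k : Type u} [Field k] (π : O →+* k) (hπ : Function.Surjective π) (hker : RingHom.ker π = maximalIdeal O)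
    (F : MvPolynomial σ O)
    (h1 : ∀ 𝔮 : PrimeSpectrum (MvPolynomial σ k), MvPolynomial.map π F ∈ 𝔮.asIdeal →
      algebraMap (MvPolynomial σ k) (Localization.AtPrime 𝔮.asIdeal) (MvPolynomial.map π F) ∉
        maximalIdeal (Localization.AtPrime 𝔮.asIdeal) ^ 2)
    (Q : Ideal (MvPolynomial σ O ⧸ Ideal.span {F})) [Q.IsPrime]
    (hQ : Ideal.Quotient.mk (Ideal.span {F}) (C ϖ : MvPolynomial σ O) ∈ Q) :
    IsRegularLocalRing (Localization.AtPrime Q) :=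
  isRegularLocalRing_localization_deltaCurve_of_forall_notMem_sq_model π hπ (hker.trans hϖ.maximalIdeal_eq) F h1 Q hQ

end Bridge

section BridgeCone

variable {O : Type} [CommRing O] [IsDomain O] [IsDiscreteValuationRing O] {ϖ : O}

/-- **BRIDGE, for the dehomogenised cone (res-type-100's chart ring, base `Λ = O`).** `O` a DVR, `π : O ↠ k` with
`ker π = (ϖ)`, `Φ ∈ O[T₁, …, T_r]` (in use: the form `(θ ∘ mk) Φ_R`), `i` a chart index, `F := Φ(Tᵢ := 1)` (tree
`Resolution.dehomogenize`). If the affine trace `V(π F) ⊂ 𝔸^{r-1}_k` is regular at every point then the chart Δ-curve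
ring `O[T_j : j ≠ i] ⧸ (F)` is a regular local ring at every prime containing `ϖ`. (`π F = (π Φ)(Tᵢ := 1)` by
`map_dehomogenize`; it is `≠ 0` as soon as `π Φ ≠ 0` is a form, `dehomogenize_ne_zero_of_isHomogeneous`.)
[cite: Matsumura1987, Thm. 14.2] [OURS · L1 W4.5b] -/
theorem isRegularLocalRing_localization_deltaCurve_dehomogenize_of_forall_notMem_sq_model
    {k : Type} [Field k] (π : O →+* k) (hπ : Function.Surjective π) (hker : RingHom.ker π = Ideal.span {ϖ})
    {r : ℕ} (i : Fin r) (Φ : MvPolynomial (Fin r) O)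
    (h1 : ∀ 𝔮 : PrimeSpectrum (MvPolynomial {j : Fin r // j ≠ i} k),
      dehomogenize i (MvPolynomial.map π Φ) ∈ 𝔮.asIdeal →
      algebraMap (MvPolynomial {j : Fin r // j ≠ i} k) (Localization.AtPrime 𝔮.asIdeal)
        (dehomogenize i (MvPolynomial.map π Φ)) ∉ maximalIdeal (Localization.AtPrime 𝔮.asIdeal) ^ 2)
    (Q : Ideal (MvPolynomial {j : Fin r // j ≠ i} O ⧸ Ideal.span {dehomogenize i Φ})) [Q.IsPrime]
    (hQ : Ideal.Quotient.mk (Ideal.span {dehomogenize i Φ}) (C ϖ : MvPolynomial {j : Fin r // j ≠ i} O) ∈ Q) :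
    IsRegularLocalRing (Localization.AtPrime Q) := by
  refine isRegularLocalRing_localization_deltaCurve_of_forall_notMem_sq_model π hπ hker (dehomogenize i Φ)
    (fun 𝔮 h𝔮 => ?_) Q hQ
  rw [map_dehomogenize] at h𝔮 ⊢
  exact h1 𝔮 h𝔮

end BridgeCone

end Summit.ResolutionOfSingularities.ResolutionOfSingularities.Cruxes.EquisingularLiftNat.Sections
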